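import Literature.MathematicalPhysics.QuantumFieldTheory.Balaban1983to89.Beta.KernelReflection
import Summits.QuantumFields.BalabanUV.Beta.FP.KernelWardBoundedBricks

/-!
# `BalabanUV.Beta.FP.KernelReflectionBounded` — road «FP» for binder row D1, sub-row **H2-ASM-5a** (symmetry letters of `PiBF`), REFLECTION HALF (Kcov), module R1:
# `Literature…Beta.KernelReflection` §3–§5 re-instanced with `Decays A C δ ↦ KernelWard.Bdd A B` — the relabelling invariance of bubble ∕ tadpole, the covariance
# of the resolvent Hessian and the difference-variable law `AxisReflectionCovariant (fun μ ν z => hessKer A V W μ ν (−z))` for a **BOUNDED** leg ([folklore]; nothing of the manuscripts)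

HONEST DEPENDENCY (page 1, mandatory): continuum YM on T⁴ ⇐ BetaPertH ∧ nine spine estimates (0/9 proved); BetaPertH ⇐ (D1) ∧ (D4) ∧ CAP+tail;
G-an2-4 gates asym, D1 and NE2/3/4.  HONEST FRAMING (cell contract, verbatim): «discharging `BetaPertH` makes Bałaban's UV stability UNCONDITIONAL —
a real constructive-QFT result; it is NOT the continuum limit and NOT the Clay problem.»  THIS MODULE DISCHARGES NOTHING of the wall: [folklore] absolutely
convergent re-indexings over an2's ABSTRACT bricks (`KernelReflection.comp_refK`, `tr_refK`, `tadpole_smul`, `bubble_smul_left∕right`, `bondRefl_sub` — leg-agnostic), an2's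
bounded-leg slices (`KernelWard.summable_slice_bdd_biLoc`), gan24-leaf-02's `KernelWardBoundedBricks.summable_slice_rl_bdd`∕`bdd_of_rl` and the BF-x road's right-localised bounds
(`D1BFx.ContactCount.abs_comp_le_of_entryBound`, `abs_comp_le_of_rightLoc`); 0 def, 0 `def … : Prop`, nothing cited, 0 sorry; 0∕4 row-D1 binders; NOT (Kcov) for `PiBF` itself
(module R2 `FP/PerfectPolarizationReflection`), NOT hgerm, NOT D1, NOT BetaPertH, NOT continuum, NOT Clay.

ABSOLUTE RULE (cell charter, verbatim): «No internally-minted statement may enter as a cited fact. Every hypothesis is either kernel-proved in this package or a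
verbatim quotation of a PUBLISHED theorem with page reference. The manuscript(s) under audit are NOT citable for their own disputed steps — they are the thing
under adjudication; programme-internal (2001/route/tribunal) claims are never citable.»

WHY (LOCATED READING L-gan24leaf02-g39-2, owner AGREED journal l.26457; R-FP-30 CORRECTED by R-FP-32 l.26550: H2-ASM-5a's second half is (Kcov) =
`AxisReflectionCovariant (flipK (PiBF …))` via the `Bdd`-leg port of `KernelReflection.axisReflectionCovariant_flip_hessKer`): every reflection producer for a `hessKer` in the
tree takes `Decays A C δ`, false for `PiBF`'s power-law legs `Pker`, `G0ker`.  The decay of the leg is used ONLY to make the three compositions and the trace absolutely convergent;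
for a bounded leg composed with vertex kernels bi-localised at common points the composed kernels are RIGHT-localised (localised in the second variable) and every series still
converges absolutely, so the relabelling identities — and with them §4–§5 of `KernelReflection` — survive verbatim.
CONTENT: §1 `summable_trSlice_rl` (one leg type of the trace series of a right-localised kernel); §2 **`bubble_refK_bdd`**, **`tadpole_refK_bdd`** (`KernelReflection.bubble_refK`∕`tadpole_refK`
with `Decays ↦ Bdd`); §3 **`hess_refl_bdd`**; §4 **`hessKer_refl_bdd`**, **`axisReflectionCovariant_flip_hessKer_bdd`** — SIGNATURES VERBATIM those of `KernelReflection` with the single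
change `(hA : Decays A C δ) ↦ (hA : Bdd A B)`.
Provenance: D1 formalisation swarm seat b2b-balaban-beta-d1-formalise-leaf-02 gen 9 (road FP engine lineage; sub-row H2-ASM-5a (Kcov) REFLECTION HALF, «MINE (Kcov)» journal l.26728), 2026-08-21.
-/

noncomputable section

namespace Summit.QuantumFields.BalabanUV.Beta.FP.KernelReflectionBounded

open Finset
open scoped BigOperators
open Literature.MathematicalPhysics.QuantumFieldTheory.Balaban1983to89
open Literature.MathematicalPhysics.QuantumFieldTheory.Balaban1983to89.Beta
open B12Sec2to5 (l1 l1_nonneg)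
open B6BondElimination (unitVec unitVec_apply)
open PolarizationSign (axisReflect axisReflect_apply reflSign AxisReflectionCovariant)
open ExpKernelCalculus (MKer Decays BiLoc comp tr bubble tadpole VertexFamily VertexFamily₂ hess hessKer BlockCovariant Zl hess_eq_hessKer summable_exp_shift')
open KernelReflection (LegMap refK refK_apply comp_refK tr_refK tadpole_smul bubble_smul_left bubble_smul_right bondRefl bondRefl_sub)
open KernelWard (Bdd summable_slice_bdd_biLoc)
open Summit.QuantumFields.BalabanUV.Beta.FP.KernelWardBoundedBricks (summable_slice_rl_bdd bdd_of_rl)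
open Summit.QuantumFields.BalabanUV.Beta.D1BFx.ContactCount (abs_comp_le_of_entryBound abs_comp_le_of_rightLoc)

variable {D : ℕ} {F : Type*} [Fintype F]

/-! ## §1 One leg type of the trace series of a right-localised kernel -/

omit [Fintype F] in
/-- [folklore] the diagonal of a kernel localised in its second variable is summable, one leg type at a time. -/
theorem summable_trSlice_rl {M : MKer D F} {K δ : ℝ} {q : Fin D → ℤ} (hM : ∀ x y a b, |M x y a b| ≤ K * Real.exp (-δ * l1 (y - q))) (hδ : 0 < δ)
    (a : F) : Summable fun x : Fin D → ℤ => M x x a a := by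
  refine Summable.of_norm_bounded ((summable_exp_shift' hδ q).mul_left K) (fun x => ?_)
  rw [Real.norm_eq_abs]
  exact hM x x a a

/-! ## §2 Relabelling invariance of bubble and tadpole for a bounded leg -/

/-- [folklore] **THE BUBBLE IS RELABELLING-INVARIANT, BOUNDED LEG**: `bubble (Φ·A) (Φ·V) (Φ·W) = bubble A V W` for a bounded `A` and vertex kernels bi-localised at `(p,p)`, `(q,q)`
(`KernelReflection.bubble_refK` with `Decays A C δ ↦ Bdd A B`; the composed kernels `A∘V`, `A∘W`, `(A∘V)∘(A∘W)` are right-localised, so every re-indexed series converges absolutely). -/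
theorem bubble_refK_bdd (Φ : LegMap D F) {A V W : MKer D F} {B Cv Cw δ : ℝ} (hA : Bdd A B) {p q : Fin D → ℤ}
    (hV : BiLoc V p p Cv δ) (hW : BiLoc W q q Cw δ) (hδ : 0 < δ) :
    bubble (refK Φ A) (refK Φ V) (refK Φ W) = bubble A V W := by
  classical
  rcases isEmpty_or_nonempty F with hF | ⟨⟨a₀⟩⟩
  · simp [ExpKernelCalculus.bubble, ExpKernelCalculus.tr]
  have hB : 0 ≤ B := (abs_nonneg _).trans (hA p p a₀ a₀)
  have h1 := abs_comp_le_of_entryBound hB hA hV hδ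
  have h2 := abs_comp_le_of_entryBound hB hA hW hδ
  have h3 := abs_comp_le_of_rightLoc h1 h2 hδ
  unfold ExpKernelCalculus.bubble
  rw [comp_refK Φ (summable_slice_bdd_biLoc hA hV hδ), comp_refK Φ (summable_slice_bdd_biLoc hA hW hδ),
    comp_refK Φ (summable_slice_rl_bdd h1 (bdd_of_rl h2 hδ.le) hδ)]
  exact tr_refK Φ (summable_trSlice_rl h3 hδ)

/-- [folklore] **THE TADPOLE IS RELABELLING-INVARIANT, BOUNDED LEG**: `tadpole (Φ·A) (Φ·W₂) = tadpole A W₂` for a bounded `A` and a bi-localised `W₂`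
(`KernelReflection.tadpole_refK` with `Decays A C δ ↦ Bdd A B`). -/
theorem tadpole_refK_bdd (Φ : LegMap D F) {A W₂ : MKer D F} {B Cw δ : ℝ} (hA : Bdd A B) {p q : Fin D → ℤ} (hW : BiLoc W₂ p q Cw δ)
    (hδ : 0 < δ) : tadpole (refK Φ A) (refK Φ W₂) = tadpole A W₂ := by
  classical
  rcases isEmpty_or_nonempty F with hF | ⟨⟨a₀⟩⟩
  · simp [ExpKernelCalculus.tadpole, ExpKernelCalculus.tr]
  have hB : 0 ≤ B := (abs_nonneg _).trans (hA p p a₀ a₀)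
  have h1 := abs_comp_le_of_entryBound hB hA hW hδ
  unfold ExpKernelCalculus.tadpole
  rw [comp_refK Φ (summable_slice_bdd_biLoc hA hW hδ)]
  exact tr_refK Φ (summable_trSlice_rl h1 hδ)

/-! ## §3 Covariance of the Hessian under a symmetry of its ingredients, bounded leg -/

/-- [folklore] **COVARIANCE OF THE RESOLVENT HESSIAN, BOUNDED LEG** (`KernelReflection.hess_refl` with `Decays A C δ ↦ Bdd A B`): if the bounded leg is relabelling-invariant
(`Φ·A = A`) and the vertex families at the image bonds are the relabelled vertex families up to the bond signs `σ`, then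
`hess μ (ρ μ y) ν (ρ ν y′) = σ μ σ ν · hess μ y ν y′`. -/
theorem hess_refl_bdd (Φ : LegMap D F) {A : MKer D F} {V : Fin D → (Fin D → ℤ) → MKer D F}
    {W : Fin D → (Fin D → ℤ) → Fin D → (Fin D → ℤ) → MKer D F} {B Cv Cw δ : ℝ} {N : ℕ}
    (hA : Bdd A B) (hV : VertexFamily V N Cv δ) (hW : VertexFamily₂ W N Cw δ) (hδ : 0 < δ) (hAr : refK Φ A = A)
    (ρ : Fin D → (Fin D → ℤ) → (Fin D → ℤ)) (σ : Fin D → ℝ) (hVr : ∀ μ y, V μ (ρ μ y) = σ μ • refK Φ (V μ y))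
    (hWr : ∀ μ y ν y', W μ (ρ μ y) ν (ρ ν y') = (σ μ * σ ν) • refK Φ (W μ y ν y'))
    (μ : Fin D) (y : Fin D → ℤ) (ν : Fin D) (y' : Fin D → ℤ) :
    hess A V W μ (ρ μ y) ν (ρ ν y') = σ μ * σ ν * hess A V W μ y ν y' := by
  unfold ExpKernelCalculus.hess
  rw [hWr, hVr, hVr, tadpole_smul, bubble_smul_left, bubble_smul_right]
  conv_lhs => rw [← hAr]
  rw [tadpole_refK_bdd Φ hA (hW μ y ν y') hδ, bubble_refK_bdd Φ hA (hV μ y) (hV ν y') hδ]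
  ring

/-! ## §4 The difference-variable law for a bounded leg -/

/-- [folklore] **THE DIFFERENCE-VARIABLE LAW OF A REFLECTION-COVARIANT RESOLVENT HESSIAN, BOUNDED LEG** (`KernelReflection.hessKer_refl` with `Decays A C δ ↦ Bdd A B`): under
block-translation covariance and the three covariance hypotheses of `hess_refl_bdd` for the bond map `bondRefl α c` with signs `reflSign α`:
`hessKer μ ν (εz + [μ=α]e_α − [ν=α]e_α) = ε_μ ε_ν · hessKer μ ν z`. -/
theorem hessKer_refl_bdd (Φ : LegMap D F) {A : MKer D F} {V : Fin D → (Fin D → ℤ) → MKer D F}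
    {W : Fin D → (Fin D → ℤ) → Fin D → (Fin D → ℤ) → MKer D F} {B Cv Cw δ : ℝ} {N : ℕ}
    (hA : Bdd A B) (hV : VertexFamily V N Cv δ) (hW : VertexFamily₂ W N Cw δ) (hδ : 0 < δ) (hcov : BlockCovariant A V W N)
    (hAr : refK Φ A = A) (α : Fin D) (c : ℤ)
    (hVr : ∀ μ y, V μ (bondRefl α c μ y) = reflSign α μ • refK Φ (V μ y))
    (hWr : ∀ μ y ν y', W μ (bondRefl α c μ y) ν (bondRefl α c ν y') = (reflSign α μ * reflSign α ν) • refK Φ (W μ y ν y'))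
    (μ ν : Fin D) (z : Fin D → ℤ) :
    hessKer A V W μ ν (axisReflect α z + (if μ = α then unitVec α else 0) - (if ν = α then unitVec α else 0))
      = reflSign α μ * reflSign α ν * hessKer A V W μ ν z := by
  have h := hess_refl_bdd Φ hA hV hW hδ hAr (bondRefl α c) (reflSign α) hVr hWr μ 0 ν z
  rw [hess_eq_hessKer hcov, hess_eq_hessKer hcov, sub_zero, bondRefl_sub, sub_zero] at h
  exact h

/-- [folklore] **`AxisReflectionCovariant (fun μ ν z => hessKer A V W μ ν (−z))` FOR A BOUNDED LEG** (`KernelReflection.axisReflectionCovariant_flip_hessKer` with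
`Decays A C δ ↦ Bdd A B`, every other binder identical): bounded leg, vertex families localised at the coarse bonds, block-translation covariance, and for every axis `α` a leg
relabelling `Φα` leaving the leg invariant under which the vertex families obey the reflection laws with the bond map `bondRefl α c` and the signs `reflSign α` ⟹ the flipped
resolvent Hessian kernel satisfies the typed predicate `PolarizationSign.AxisReflectionCovariant` verbatim. -/
theorem axisReflectionCovariant_flip_hessKer_bdd {A : MKer D F} {V : Fin D → (Fin D → ℤ) → MKer D F}
    {W : Fin D → (Fin D → ℤ) → Fin D → (Fin D → ℤ) → MKer D F} {B Cv Cw δ : ℝ} {N : ℕ}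
    (hA : Bdd A B) (hV : VertexFamily V N Cv δ) (hW : VertexFamily₂ W N Cw δ) (hδ : 0 < δ) (hcov : BlockCovariant A V W N)
    (hAr : ∀ α : Fin D, ∃ Φα : LegMap D F, refK Φα A = A ∧ ∃ c : ℤ,
      (∀ μ y, V μ (bondRefl α c μ y) = reflSign α μ • refK Φα (V μ y)) ∧
      (∀ μ y ν y', W μ (bondRefl α c μ y) ν (bondRefl α c ν y') = (reflSign α μ * reflSign α ν) • refK Φα (W μ y ν y'))) :
    AxisReflectionCovariant (fun μ ν z => hessKer A V W μ ν (-z)) := by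
  intro α μ ν z
  obtain ⟨Φα, hA', c, hVr, hWr⟩ := hAr α
  have h := hessKer_refl_bdd Φα hA hV hW hδ hcov hA' α c hVr hWr μ ν (-z)
  have e : -(axisReflect α z - (if μ = α then unitVec α else 0) + (if ν = α then unitVec α else 0))
      = axisReflect α (-z) + (if μ = α then unitVec α else 0) - (if ν = α then unitVec α else 0) := by
    funext i
    simp only [Pi.neg_apply, Pi.sub_apply, Pi.add_apply, axisReflect_apply]
    by_cases hi : i = α <;> by_cases hμ : μ = α <;> by_cases hν : ν = α <;> simp [hi, hμ, hν, unitVec_apply] <;> ring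
  show hessKer A V W μ ν (-(axisReflect α z - (if μ = α then unitVec α else 0) + (if ν = α then unitVec α else 0)))
    = reflSign α μ * reflSign α ν * hessKer A V W μ ν (-z)
  rw [e]
  exact h

end Summit.QuantumFields.BalabanUV.Beta.FP.KernelReflectionBounded

end
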